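import Summits.QuantumFields.YangMills.Theorems.BalabanUVNodesN12FlatChartDerivIterLin
import Summits.QuantumFields.YangMills.Theorems.BalabanUVNodesN07CritTangentConverse

/-!
# BalabanUVNodes ∕ N12 — (J-iii): THE LINEARISED MULTI-SCALE (0.4)-CONSTRAINT AT A GUARDED (CURVED) BACKGROUND — its `DΨ(0)` BY NAME in velocity currency,
# the derivative of the smooth matrix extension `Ū^j` at the flat configuration IDENTIFIED with the `linAvg`-recursion `Q^{(j)}`, and the DEVIATION of the
# guarded linearisation from `Q^{(j)}` bounded by `K·‖↑U − 1‖` near the flat configuration (the letter the N12 roads U1a(β) ∕ U2c⁺ absorb into `Cerr`)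

Cell `pub-ymgap` (HUMAN RULINGS D-0062 ∕ D-0149), width seat `pub-ymgap-dag-n10-w1` g0; lane word dag-n12-c g16 (bus l.≈26550): «the CURVED∕GUARDED-background edition of B =
(J-iii) … output currency: the linearised constraint map as `DΨ(0)` in n12-w3's binder shape + its deviation from the straight average bounded by `C·‖U − 1‖` on the guard».
Key K1⁷ `stmt-QuantumFields-20542`, `--kind proof --supports … --as helper`; count-neutral; THEOREMS ONLY (0 `def`, 0 `sorry`, 0 `instance`).  CONSUMED BY NAME, nothing
modified: this seat's module B `…N12FlatChartDerivIterLin` (flat velocity `hasDerivAt_coe_iter_expChart_one_smul`), n07-e's 35b-i `Node00.AveragingSmooth` (`iterM`, `coeField`,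
`contDiffAt_iterM`, `coeField_iter_eq_iterM`, `SmallBelow`) and 35e `…N07CritTangentConverse.{hasDerivAt_coeField_iter, smallBelow_of_plaqSmall}`, n07-w2's
`Node00.MultiScaleFibreChart.fderiv_msChart_apply_of_hasDerivAt`, `T3DescentFibreTower.{plaqSmall_one, avgFun_one, expMeanLogSU_E_one}`, UST's `BlockAvgCorrector.stokesConst`,
Mathlib (`ContDiffAt.fderiv_right`, `ContDiffAt.exists_lipschitzOnWith`).

THE PRINT.  [Balaban1985Averaging] Prop. 3 (121)–(125) p. 36 — at a background `V₀` the linearised average is «the main term `L(Q(V₀)A)` … the remaining terms are small … can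
be estimated by `O(L²α₀)` … `O(1)L²α₀L|A|`»; [Balaban1985Variational] Sect. C (44)–(48) p. 285 (the linearised averaging of the variational problem at a background);
[Balaban1987RG1] (0.4) p. 253, (0.21) p. 256.

CONTENTS.
§1 (any torus `P`, the (0.4) family `blockAvg expMeanLogSU`) ★★ `fderiv_iterM_one_apply_eq_iterLin` — the Fréchet derivative of n07-e's C^∞ matrix extension `iterM k` AT THE FLAT
   CONFIGURATION, applied to an `𝔰𝔲(N)`-valued direction, IS `Q^{(k)}` (module B's velocity + 35e's velocity + uniqueness of derivatives).
§2 ★★ `exists_norm_fderiv_iterM_sub_iterLin_le` — THE DEVIATION LETTER: there are `K` and `ρ > 0` such that for EVERY configuration `U` whose bond matrices are within `ρ` of the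
   flat ones (sup norm), the guarded linearisation of `Ū^k` at `↑U` differs from `Q^{(k)}` by at most `K·‖↑U − 1‖·‖X‖` on `𝔰𝔲(N)`-valued directions `X` (C^∞ ⇒ the derivative is
   Lipschitz near `↑1`); `exists_norm_iterM_sub_one_le` (the averages themselves: `‖↑(Ū^k U)(·) − 1‖ ≤ K·‖↑U − 1‖` near `1`).
§3 (NODE 00's objects, `avOfRecord F N K = fun _ => blockAvg expMeanLogSU` by `rfl`) ★ `fderiv_msChart_apply_eq_of_plaqSmall` — AT ANY `U` whose iterated averages are `t₀`-small
   (`stokesConst·t₀ < δ_N`), with its own datum `W := M˙(U)`: `(DΦ_U(0)X)_{(j,c)} = π((M˙U)_j(c)* · (D(Ū^j)(↑U)(↑U·↑X))(c))` — n12-w3's `fderiv ℝ Ψ 0` BY NAME in 35e's velocity currency.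

HONEST FRAMING.  §1 exact; §2 the constants `K, ρ` EXIST by smoothness on a neighbourhood of the flat configuration — print's explicit `O(L²α₀)` ([14] (124)) is NOT claimed (UST's
`BlockAveragingEMLLinearisedBackground` carries the quantitative one-step form with the `α|Y|` term inside its remainder); the guard is DISPLAYED as `‖↑U − 1‖ < ρ` resp. `PlaqSmall t₀`;
§3 is bookkeeping by name; the chart-level deviation (adding the `W_j(c)* − 1` and `↑U_b − 1` twists to §2) is left to the consumer's currency.  Nothing of Bałaban's estimates
asserted; N12 NOT discharged; count-neutral (typed 28∕28 · discharged 5∕27 unmoved); one finite 𝕋⁴ programme at fixed ε — R4 closes the conditional rung `BalabanLadder.UV` only;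
the YM mass gap (Clay) is NOT proved by any of this.  No `sorry`, no `def`, no `instance`, no `notation`.
-/

noncomputable section

open scoped BigOperators Matrix.Norms.L2Operator Topology NNReal
open Filter Asymptotics Finset

namespace Summit.QuantumFields.YangMills.BalabanUVNodes.N12GuardedChartDerivIterLin

open Literature.MathematicalPhysics.QuantumFieldTheory.Balaban1983to89
open T4Continuum (T4Family)
open BlockAveraging (blockAvg)
open ExpMeanLog (expMeanLogSU deltaSU deltaSU_pos)
open BlockAveragingEMLLinearised (linAvg)
open T4AdjointCovarianceUnitary (lieSU expSU)
open B15DeterminingSets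
open Node00
open Summit.QuantumFields.YangMills.Theorems.BlockAvgCorrector (stokesConst stokesConst_nonneg)
open Summit.QuantumFields.YangMills.BalabanUVNodes.N07CritTangentConverse (hasDerivAt_coeField_iter smallBelow_of_plaqSmall)
open Summit.QuantumFields.YangMills.BalabanUVNodes.N12FlatChartDerivIterLin (hasDerivAt_coe_iter_expChart_one_smul hasDerivAt_coe_expChart_one_smul)

/-! ## §1  The derivative of the smooth extension `iterM k` at the flat configuration is `Q^{(k)}` on `𝔰𝔲(N)`-valued directions -/

section Flat

variable {P : Params} {N : ℕ} [NeZero N]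

/-- A positive smallness threshold with `stokesConst·t₀ < δ_N` (half of the admissible one). [cite: Balaban1987RG1, (0.4) p.253 (bookkeeping)] -/
theorem exists_stokesThreshold : ∃ t₀ : ℝ, 0 < t₀ ∧ stokesConst P * t₀ < deltaSU (Fin N) := by
  refine ⟨deltaSU (Fin N) / (2 * (stokesConst P + 1)), by have := deltaSU_pos (n := Fin N); have := stokesConst_nonneg P; positivity, ?_⟩
  have hδ := deltaSU_pos (n := Fin N)
  have hs := stokesConst_nonneg P
  rw [mul_div_assoc']
  rw [div_lt_iff₀ (by positivity)]
  nlinarith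

/-- The (0.4) family fixes the flat configuration at every level (generic torus; private twin of `B15Claim189UnitTestAtRecord.iter_avOfRecord_one`).
[cite: Balaban1987RG1, (0.4) p.253 (bookkeeping)] -/
private theorem iter_one : ∀ k : ℕ,
    Averaging.iter (fun i => blockAvg (P := P) (j := i) (expMeanLogSU (n := Fin N))) k (1 : GaugeField P 0 (SU N)) = 1
  | 0 => rfl
  | k + 1 => by
    show (blockAvg expMeanLogSU).avg (Averaging.iter (fun i => blockAvg (P := P) (j := i) (expMeanLogSU (n := Fin N))) k 1) = 1
    rw [iter_one k, BlockAveraging.blockAvg_avg]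
    exact T3DescentFibreTower.avgFun_one _ T3DescentFibreTower.expMeanLogSU_E_one

/-- The iterated averages of the flat configuration are `t₀`-small for every `t₀ > 0`. [cite: Balaban1987RG1, (0.4) p.253 (bookkeeping)] -/
theorem plaqSmall_iter_one {t₀ : ℝ} (ht₀ : 0 < t₀) (i : ℕ) :
    PlaqSmall t₀ (Averaging.iter (fun i => blockAvg (P := P) (j := i) (expMeanLogSU (n := Fin N))) i (1 : GaugeField P 0 (SU N))) := by
  rw [iter_one]
  exact T3DescentFibreTower.plaqSmall_one ht₀

/-- The flat configuration is on the guard of (0.4) below every level. [cite: Balaban1987RG1, (0.4) p.253 (bookkeeping)] -/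
theorem smallBelow_one (k : ℕ) : SmallBelow (fun i => blockAvg (P := P) (j := i) (expMeanLogSU (n := Fin N))) k (1 : GaugeField P 0 (SU N)) := by
  obtain ⟨t₀, ht₀, hst⟩ := exists_stokesThreshold (P := P) (N := N)
  exact smallBelow_of_plaqSmall ht₀ hst fun i _ => plaqSmall_iter_one ht₀ i

/-- The matrix field of the flat configuration is the constant `1`. [folklore] -/
theorem coeField_one : coeField (1 : GaugeField P 0 (SU N)) = 1 := by
  funext b; rfl

/-- ★★ **THE DERIVATIVE OF THE SMOOTH EXTENSION `Ū^k` AT THE FLAT CONFIGURATION IS THE `linAvg`-RECURSION**: for the recursion family `Q` (`Q 0 = id`, `Q (i+1) = linAvg ∘ Q i`) and every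
`𝔰𝔲(N)`-valued direction `X`, `fderiv ℝ (iterM k) ↑1 ↑X = Q^{(k)} ↑X` — the velocity of `t ↦ ↑Ū^k(1·exp(tX))` computed twice (35e: the Fréchet derivative of `iterM k` applied to the chart
velocity `↑X`; module B: `Q^{(k)}↑X`) and uniqueness of derivatives. [cite: Balaban1985Averaging, Prop. 3 (121)-(125) p.36; Balaban1987RG1, (0.21) p.256] -/
theorem fderiv_iterM_one_apply_eq_iterLin
    (Q : (i : ℕ) → (PBond P 0 → Matrix (Fin N) (Fin N) ℂ) → PBond P i → Matrix (Fin N) (Fin N) ℂ)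
    (hQ0 : ∀ Y, Q 0 Y = Y) (hQs : ∀ (i : ℕ) (Y : PBond P 0 → Matrix (Fin N) (Fin N) ℂ) (c : PBond P (i + 1)), Q (i + 1) Y c = linAvg (Q i Y) c)
    (k : ℕ) (X : PBond P 0 → lieSU (Fin N)) :
    fderiv ℝ (iterM k : (PBond P 0 → Matrix (Fin N) (Fin N) ℂ) → PBond P k → Matrix (Fin N) (Fin N) ℂ) (coeField (1 : GaugeField P 0 (SU N)))
        (fun b => (X b : Matrix (Fin N) (Fin N) ℂ))
      = Q k (fun b => (X b : Matrix (Fin N) (Fin N) ℂ)) := by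
  obtain ⟨t₀, ht₀, hst⟩ := exists_stokesThreshold (P := P) (N := N)
  -- the chart curve through `1` and its velocity `↑X`
  have hΓ : HasDerivAt (fun t : ℝ => coeField (expChart (1 : GaugeField P 0 (SU N)) (t • X))) (fun b => (X b : Matrix (Fin N) (Fin N) ℂ)) 0 :=
    hasDerivAt_pi.2 fun b => hasDerivAt_coe_expChart_one_smul X b
  -- velocity via the smooth extension (35e)
  have h1 := hasDerivAt_coeField_iter (k := k) ht₀ hst hΓ (fun i _ => by
    rw [zero_smul, expChart_zero]; exact plaqSmall_iter_one ht₀ i)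
  -- velocity via module B
  have h2 : HasDerivAt (fun t : ℝ => coeField (Averaging.iter (fun i => blockAvg (P := P) (j := i) (expMeanLogSU (n := Fin N))) k
      (expChart (1 : GaugeField P 0 (SU N)) (t • X))))
      (fun c => Q k (fun b => (X b : Matrix (Fin N) (Fin N) ℂ)) c) 0 :=
    hasDerivAt_pi.2 fun c => hasDerivAt_coe_iter_expChart_one_smul Q hQ0 hQs X k c
  have h := h1.unique h2
  rw [zero_smul, expChart_zero] at h
  exact h

end Flat

/-! ## §2  The deviation of the guarded linearisation from `Q^{(k)}` near the flat configuration -/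

section Deviation

variable {P : Params} {N : ℕ} [NeZero N]

/-- ★★ **THE DEVIATION LETTER.**  There are `K ≥ 0` and `ρ > 0` such that for EVERY configuration `U` with `‖↑U − 1‖ < ρ` (sup norm of the bond matrices) and every `𝔰𝔲(N)`-valued direction
`X`: `‖D(Ū^k)(↑U) ↑X − Q^{(k)} ↑X‖ ≤ K·‖↑U − 1‖·‖↑X‖`, where `D(Ū^k)(↑U) = fderiv ℝ (iterM k) ↑U` is the linearisation of n07-e's C^∞ matrix extension (= the linearised k-fold (0.4)-constraint
at `U` whenever `U` is on the guard, 35e).  Proof: `iterM k` is C^∞ at `↑1` (35b-i), so its Fréchet derivative is C¹ hence Lipschitz on a neighbourhood of `↑1` (Mathlib), and at `↑1` it is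
`Q^{(k)}` on `𝔰𝔲(N)`-valued directions (§1).  The explicit `O(L²α₀)` of [Balaban1985Averaging] (124) is NOT claimed — only existence of the constant near the flat configuration.
[cite: Balaban1985Averaging, Prop. 3 (121)-(125) p.36; Balaban1985Variational, (44)-(48) p.285] -/
theorem exists_norm_fderiv_iterM_sub_iterLin_le
    (Q : (i : ℕ) → (PBond P 0 → Matrix (Fin N) (Fin N) ℂ) → PBond P i → Matrix (Fin N) (Fin N) ℂ)
    (hQ0 : ∀ Y, Q 0 Y = Y) (hQs : ∀ (i : ℕ) (Y : PBond P 0 → Matrix (Fin N) (Fin N) ℂ) (c : PBond P (i + 1)), Q (i + 1) Y c = linAvg (Q i Y) c)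
    (k : ℕ) :
    ∃ K ρ : ℝ, 0 ≤ K ∧ 0 < ρ ∧ ∀ U : GaugeField P 0 (SU N), ‖coeField U - 1‖ < ρ → ∀ X : PBond P 0 → lieSU (Fin N),
      ‖fderiv ℝ (iterM k : (PBond P 0 → Matrix (Fin N) (Fin N) ℂ) → PBond P k → Matrix (Fin N) (Fin N) ℂ) (coeField U)
            (fun b => (X b : Matrix (Fin N) (Fin N) ℂ)) - Q k (fun b => (X b : Matrix (Fin N) (Fin N) ℂ))‖
        ≤ K * ‖coeField U - 1‖ * ‖(fun b => (X b : Matrix (Fin N) (Fin N) ℂ))‖ := by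
  -- `D := fderiv (iterM k)` is C¹ at `↑1`, hence Lipschitz near `↑1`
  have hC : ContDiffAt ℝ ⊤ (iterM k : (PBond P 0 → Matrix (Fin N) (Fin N) ℂ) → PBond P k → Matrix (Fin N) (Fin N) ℂ)
      (coeField (1 : GaugeField P 0 (SU N))) := contDiffAt_iterM k (smallBelow_one k)
  have hD : ContDiffAt ℝ 1 (fderiv ℝ (iterM k : (PBond P 0 → Matrix (Fin N) (Fin N) ℂ) → PBond P k → Matrix (Fin N) (Fin N) ℂ))
      (coeField (1 : GaugeField P 0 (SU N))) := hC.fderiv_right le_top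
  obtain ⟨K, t, ht, hLip⟩ := hD.exists_lipschitzOnWith
  obtain ⟨ρ, hρ, hball⟩ := Metric.mem_nhds_iff.1 ht
  refine ⟨K, ρ, K.2, hρ, fun U hU X => ?_⟩
  have h1 : coeField (1 : GaugeField P 0 (SU N)) ∈ t := hball (Metric.mem_ball_self hρ)
  have hU' : coeField U ∈ t := hball (by rw [Metric.mem_ball, dist_eq_norm, coeField_one]; exact hU)
  have hdist := hLip.dist_le_mul _ hU' _ h1
  rw [dist_eq_norm, dist_eq_norm] at hdist
  -- apply the operator-norm bound to the direction `↑X` and use §1 at `↑1`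
  set Xm : PBond P 0 → Matrix (Fin N) (Fin N) ℂ := fun b => (X b : Matrix (Fin N) (Fin N) ℂ)
  have hflat := fderiv_iterM_one_apply_eq_iterLin Q hQ0 hQs k X
  calc ‖fderiv ℝ (iterM k : (PBond P 0 → Matrix (Fin N) (Fin N) ℂ) → PBond P k → Matrix (Fin N) (Fin N) ℂ) (coeField U) Xm - Q k Xm‖
      = ‖(fderiv ℝ (iterM k : (PBond P 0 → Matrix (Fin N) (Fin N) ℂ) → PBond P k → Matrix (Fin N) (Fin N) ℂ) (coeField U)
          - fderiv ℝ (iterM k : (PBond P 0 → Matrix (Fin N) (Fin N) ℂ) → PBond P k → Matrix (Fin N) (Fin N) ℂ) (coeField 1)) Xm‖ := by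
        rw [show ∀ (A B : (PBond P 0 → Matrix (Fin N) (Fin N) ℂ) →L[ℝ] (PBond P k → Matrix (Fin N) (Fin N) ℂ)) (v : PBond P 0 → Matrix (Fin N) (Fin N) ℂ),
            (A - B) v = A v - B v from fun A B v => rfl, hflat]
    _ ≤ ‖fderiv ℝ (iterM k : (PBond P 0 → Matrix (Fin N) (Fin N) ℂ) → PBond P k → Matrix (Fin N) (Fin N) ℂ) (coeField U)
          - fderiv ℝ (iterM k : (PBond P 0 → Matrix (Fin N) (Fin N) ℂ) → PBond P k → Matrix (Fin N) (Fin N) ℂ) (coeField 1)‖ * ‖Xm‖ :=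
        ContinuousLinearMap.le_opNorm _ _
    _ ≤ (K : ℝ) * ‖coeField U - coeField (1 : GaugeField P 0 (SU N))‖ * ‖Xm‖ := mul_le_mul_of_nonneg_right hdist (norm_nonneg _)
    _ = K * ‖coeField U - 1‖ * ‖Xm‖ := by rw [coeField_one]

/-- **The averages themselves stay close**: there are `K ≥ 0`, `ρ > 0` with `‖iterM k ↑U − 1‖ ≤ K·‖↑U − 1‖` whenever `‖↑U − 1‖ < ρ` (C¹ ⇒ Lipschitz near `↑1`, and `iterM k ↑1 = 1`); under the guard
`iterM k ↑U` is the matrix field of `Ū^k(U)` (35b-i `coeField_iter_eq_iterM`). [cite: Balaban1987RG1, (0.4) p.253, (0.21) p.256] -/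
theorem exists_norm_iterM_sub_one_le (k : ℕ) :
    ∃ K ρ : ℝ, 0 ≤ K ∧ 0 < ρ ∧ ∀ U : GaugeField P 0 (SU N), ‖coeField U - 1‖ < ρ →
      ‖(iterM k : (PBond P 0 → Matrix (Fin N) (Fin N) ℂ) → PBond P k → Matrix (Fin N) (Fin N) ℂ) (coeField U) - 1‖ ≤ K * ‖coeField U - 1‖ := by
  have hC : ContDiffAt ℝ 1 (iterM k : (PBond P 0 → Matrix (Fin N) (Fin N) ℂ) → PBond P k → Matrix (Fin N) (Fin N) ℂ)
      (coeField (1 : GaugeField P 0 (SU N))) := (contDiffAt_iterM k (smallBelow_one k)).of_le le_top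
  obtain ⟨K, t, ht, hLip⟩ := hC.exists_lipschitzOnWith
  obtain ⟨ρ, hρ, hball⟩ := Metric.mem_nhds_iff.1 ht
  refine ⟨K, ρ, K.2, hρ, fun U hU => ?_⟩
  have h1 : coeField (1 : GaugeField P 0 (SU N)) ∈ t := hball (Metric.mem_ball_self hρ)
  have hU' : coeField U ∈ t := hball (by rw [Metric.mem_ball, dist_eq_norm, coeField_one]; exact hU)
  have hdist := hLip.dist_le_mul _ hU' _ h1
  rw [dist_eq_norm, dist_eq_norm] at hdist
  have hone : (iterM k : (PBond P 0 → Matrix (Fin N) (Fin N) ℂ) → PBond P k → Matrix (Fin N) (Fin N) ℂ) (coeField (1 : GaugeField P 0 (SU N))) = 1 := by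
    rw [← coeField_iter_eq_iterM k (smallBelow_one k), iter_one]
    funext c; rfl
  rw [hone, coeField_one] at hdist
  exact hdist

end Deviation

/-! ## §3  At NODE 00's objects: the chart derivative at a guarded configuration, by name -/

section Guarded

variable {F : T4Family} {N : ℕ} [NeZero N] {K k : ℕ}

/-- ★ **`DΨ_U(0)` IN VELOCITY CURRENCY AT A GUARDED CONFIGURATION.**  Let the iterated averages `Ū^i(U)`, `i < k`, be `t₀`-small with `stokesConst·t₀ < δ_N` (35e's guard).  Then for the
multi-scale chart of n07-w2 at `U` with ITS OWN datum `W := M˙(U)` and every level-bounded determining set `𝔹`, the derivative at `0` applied to `X : bonds → 𝔰𝔲(N)` has at the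
constrained bond `i ↔ (j, c)` the component `π((M˙U)_j(c)* · (D(Ū^j)(↑U)(b ↦ ↑U_b·↑X_b))(c))` — `D(Ū^j)(↑U) = fderiv ℝ (iterM j) ↑U`, the linearised j-fold (0.4)-constraint at `U`
(whose deviation from `Q^{(j)}` near the flat configuration is §2).  This is n12-w3's `fderiv ℝ Ψ 0` for `Ψ := msChart F N K k 𝔹 (M˙U) U`.
[cite: Balaban1985Variational, (44)-(48) p.285, (83) p.290; Balaban1987RG1, (0.21) p.256] -/
theorem fderiv_msChart_apply_eq_of_plaqSmall {t₀ : ℝ} (ht₀ : 0 < t₀) (hstδ : stokesConst (F.P K) * t₀ < deltaSU (Fin N))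
    {U : GaugeField (F.P K) 0 (SU N)} (hsm : ∀ i, i < k → PlaqSmall t₀ (Averaging.iter (avOfRecord F N K) i U))
    (𝔹 : DetSet (F.P K)) (X : PBond (F.P K) 0 → lieSU (Fin N)) (i : Fin (constrCard 𝔹 k)) :
    fderiv ℝ (msChart F N K k 𝔹 (avgFamily (avOfRecord F N K) U) U) 0 X i
      = suProj N (star ((avgFamily (avOfRecord F N K) U ((constrEnum 𝔹 k).symm i).1 ((constrEnum 𝔹 k).symm i).2.1 : SU N) : Matrix (Fin N) (Fin N) ℂ) *
          fderiv ℝ (iterM (((constrEnum 𝔹 k).symm i).1 : ℕ) : (PBond (F.P K) 0 → Matrix (Fin N) (Fin N) ℂ) → PBond (F.P K) ((constrEnum 𝔹 k).symm i).1 → Matrix (Fin N) (Fin N) ℂ)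
            (coeField U) (fun b => (U b : Matrix (Fin N) (Fin N) ℂ) * (X b : Matrix (Fin N) (Fin N) ℂ)) ((constrEnum 𝔹 k).symm i).2.1) := by
  set s := (constrEnum 𝔹 k).symm i with hs
  have hj : (s.1 : ℕ) ≤ k := Nat.lt_succ_iff.1 s.1.2
  -- the chart curve through `U` and its velocity `b ↦ ↑U_b·↑X_b`
  have hΓ : HasDerivAt (fun t : ℝ => coeField (expChart U (t • X))) (fun b => (U b : Matrix (Fin N) (Fin N) ℂ) * (X b : Matrix (Fin N) (Fin N) ℂ)) 0 :=
    hasDerivAt_pi.2 fun b => hasDerivAt_coe_expChart_along (hasDerivAt_ray X) (zero_smul ℝ X) b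
  have hsm' : ∀ i', i' < (s.1 : ℕ) → PlaqSmall t₀ (Averaging.iter (fun i => blockAvg (P := F.P K) (j := i) (expMeanLogSU (n := Fin N))) i' (expChart U ((0 : ℝ) • X))) :=
    fun i' hi' => by rw [zero_smul, expChart_zero]; exact hsm i' (lt_of_lt_of_le hi' hj)
  have hvel := hasDerivAt_coeField_iter (k := (s.1 : ℕ)) ht₀ hstδ hΓ hsm'
  have hvelc : HasDerivAt (fun t : ℝ => ((avgFamily (avOfRecord F N K) (expChart U (t • X)) s.1 s.2.1 : SU N) : Matrix (Fin N) (Fin N) ℂ))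
      (fderiv ℝ (iterM (s.1 : ℕ) : (PBond (F.P K) 0 → Matrix (Fin N) (Fin N) ℂ) → PBond (F.P K) s.1 → Matrix (Fin N) (Fin N) ℂ)
        (coeField U) (fun b => (U b : Matrix (Fin N) (Fin N) ℂ) * (X b : Matrix (Fin N) (Fin N) ℂ)) s.2.1) 0 := by
    have h := (hasDerivAt_pi.1 hvel) s.2.1
    rw [zero_smul, expChart_zero] at h
    exact h
  have hsb : SmallBelow (avOfRecord F N K) k U := smallBelow_of_plaqSmall ht₀ hstδ hsm
  exact fderiv_msChart_apply_of_hasDerivAt (fun _ _ _ => rfl) hsb X i hvelc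

end Guarded

end Summit.QuantumFields.YangMills.BalabanUVNodes.N12GuardedChartDerivIterLin

end
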